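import Literature.NumberTheory.EllipticCurves.MordellCurvePhiDescentHom
import Mathlib.RingTheory.Valuation.Basic
import Mathlib.Algebra.GroupWithZero.WithZero
import HarnessLib

/-!
# The `φ`-descent values `Y + B` on `Y² = X³ + B²` have cube valuations off `v(2B) ≠ 1`

Topic `NumberTheory/EllipticCurves`. The cubic analogue of the tree's
`Literature/NumberTheory/EllipticCurves/TwoDescentParity.lean` (Silverman, *AEC*, Thm. X.1.1(c) for
the `2`-descent: the descent classes are unramified outside `S`): for the `φ`-descent map
`δ : (X, Y) ↦ Y + B` on the Mordell curve `E'_B : Y² = X³ + B²` (tree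
`MordellDescent.cubicDescent`; Cassels 1964) and ANY `ℤᵐ⁰`-valued valuation `v` of the field with
`v(2B) = 1`, every value of `δ` has valuation in `3ℤ`:

* `Valuation.three_dvd_log_of_mul_eq_cube`: if `a b = x³`, `a, b ≠ 0` and `v(a − b) = 1` then
  `3 ∣ log v(a)` — if `v a ≠ v b` then `max (v a) (v b) = v(a − b) = 1`, so `v a = 1` or
  `v a = v(x)³`; if `v a = v b` then `v(a)² = v(x)³`;
* `Valuation.three_dvd_log_cubicDescent`: hence `3 ∣ log v(δ(P))` for every point `P` of
  `E'_B` (`a = Y + B`, `b = Y − B`; at `O`, `±T'` the values `1`, `2B`, `(2B)²` are `v`-units).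

This is the local condition at every place `v ∤ 6B… ` precisely at every `v` with `v(2B) = 1` —
including the prime above `3` when `3 ∤ B` — of the `√−3`-descent on the cubic twists
`y² = x³ + (2^a 5^b)²` (`Literature/Barriers/BirchSwinnertonDyer/RankNotSumOfLocalInvariantsCubicTwists.lean`),
and the input of their `S`-unit reduction. Theorems only. `ord_v = log ∘ v` up to sign (Mathlib's
normalised valuations are `exp(−ord_v)`; signs are immaterial for divisibility).

## References

* J. H. Silverman, *The Arithmetic of Elliptic Curves*, 2nd ed., GTM 106 (2009), Thm. X.1.1(c)
  and Prop. X.4.9 (the image of a descent map is unramified outside the bad primes).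
  [SilvermanAEC2009]
* J. W. S. Cassels, *Arithmetic on curves of genus 1. VI*, J. reine angew. Math. 214/215 (1964),
  p. 65 (the descent map `Y + 9c` modulo cubes). [Cassels1964ArithmeticVI]
-/

open scoped WithZero

namespace Valuation

variable {L : Type*} [Field L] (v : Valuation L ℤᵐ⁰)

/-- **`a b = x³`, `v(a − b) = 1` ⟹ `3 ∣ ord_v(a)`** (`a, b ≠ 0`): if `v a ≠ v b` then
`max (v a) (v b) = v(a − b) = 1`, so either `v a = 1` or `v b = 1` and `v a = v(x)³`; if
`v a = v b` then `v(a)² = v(x)³`. The local computation behind "the descent map is unramified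
outside the primes dividing `2B`". [cite: SilvermanAEC2009, Thm. X.1.1(c)] -/
theorem three_dvd_log_of_mul_eq_cube {a b x : L} (ha : a ≠ 0) (hb : b ≠ 0) (hsub : v (a - b) = 1)
    (h : a * b = x ^ 3) : (3 : ℤ) ∣ WithZero.log (v a) := by
  have hva : v a ≠ 0 := (v.ne_zero_iff).mpr ha
  have hvb : v b ≠ 0 := (v.ne_zero_iff).mpr hb
  have hx : x ≠ 0 := by
    rintro rfl
    rw [zero_pow three_ne_zero, mul_eq_zero] at h
    exact h.elim ha hb
  have hvx : v x ≠ 0 := (v.ne_zero_iff).mpr hx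
  have hprod : v a * v b = v x ^ 3 := by rw [← map_mul, h, map_pow]
  by_cases hab : v a = v b
  · -- `v(a)² = v(x)³`
    have key : v a ^ 2 = v x ^ 3 := by rw [sq, ← hprod, hab]
    have hlog := congrArg WithZero.log key
    rw [WithZero.log_pow, WithZero.log_pow, nsmul_eq_mul, nsmul_eq_mul] at hlog
    push_cast at hlog
    exact ⟨WithZero.log (v a) - WithZero.log (v x), by linarith⟩
  · -- `max (v a) (v b) = 1`
    have hmax : max (v a) (v b) = 1 := by
      have := v.map_add_of_distinct_val (x := a) (y := -b) (by rwa [map_neg])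
      rw [← sub_eq_add_neg, hsub, map_neg] at this
      exact this.symm
    rcases lt_or_gt_of_ne hab with hlt | hlt
    · -- `v a < v b = 1`, `v a = v x ^ 3`
      have hb1 : v b = 1 := by rw [max_eq_right hlt.le] at hmax; exact hmax
      rw [hb1, mul_one] at hprod
      have hlog := congrArg WithZero.log hprod
      rw [WithZero.log_pow, nsmul_eq_mul] at hlog
      push_cast at hlog
      exact ⟨WithZero.log (v x), by linarith⟩
    · have ha1 : v a = 1 := by rw [max_eq_left hlt.le] at hmax; exact hmax
      rw [ha1, WithZero.log_one]
      exact dvd_zero 3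

open Literature.NumberTheory.EllipticCurves Literature.NumberTheory.EllipticCurves.MordellDescent
  WeierstrassCurve in
/-- **`3 ∣ ord_v(δ(P))` for every point `P` of `E'_B : Y² = X³ + B²` whenever `v(2B) = 1`**, `δ` the
`φ`-descent map `MordellDescent.cubicDescent` (`(X, Y) ↦ Y + B`, `O ↦ 1`, `−T' ↦ (2B)²`): off
`X = 0`, `(Y + B)(Y − B) = X³` with `(Y + B) − (Y − B) = 2B` a `v`-unit
(`three_dvd_log_of_mul_eq_cube`); at `O, ±T'` the values are the units `1, 2B, (2B)²`.
[cite: SilvermanAEC2009, Thm. X.1.1(c)] -/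
theorem three_dvd_log_cubicDescent {W : WeierstrassCurve L} {B : L} (hW : W = mordellCurve (B ^ 2))
    (hv : v (2 * B) = 1) (P : W.toAffine.Point) :
    (3 : ℤ) ∣ WithZero.log (v (cubicDescent W B P)) := by
  have h2B : (2 : L) * B ≠ 0 := fun h0 ↦ by rw [h0, map_zero] at hv; exact zero_ne_one hv
  have hB : B ≠ 0 := fun h0 ↦ h2B (by rw [h0, mul_zero])
  rcases P with _ | ⟨X, Y, hP⟩
  · rw [← Affine.Point.zero_def, cubicDescent_zero, map_one, WithZero.log_one]; exact dvd_zero 3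
  · have hE : Y ^ 2 = X ^ 3 + B ^ 2 := (equation_iff_of_eq hW X Y).mp hP.1
    rw [cubicDescent_some]
    split_ifs with hY
    · rw [map_pow, hv, one_pow, WithZero.log_one]; exact dvd_zero 3
    · by_cases hX : X = 0
      · -- `P = T' = (0, B)`: value `2B`
        have hYB : Y = B := by
          rcases y_eq_or_of_x_eq_zero hW hP.1 hX with h | h
          · exact h
          · exact absurd h hY
        rw [hYB, ← two_mul, hv, WithZero.log_one]; exact dvd_zero 3
      · refine v.three_dvd_log_of_mul_eq_cube (b := Y - B) (x := X) (fun h ↦ hY ?_)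
          (fun h ↦ hX ?_) (by rw [show Y + B - (Y - B) = 2 * B by ring, hv]) ?_
        · linear_combination h
        · -- `Y = B` forces `X³ = 0`
          have : X ^ 3 = 0 := by
            have hYB : Y = B := by linear_combination h
            rw [hYB] at hE; linear_combination hE.symm
          exact pow_eq_zero_iff three_ne_zero |>.mp this
        · linear_combination hE

end Valuation
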